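import Summits.ValiantsHypothesis.ValiantsHypothesis.Theorems.BarrierLeverPartitionMinorsHitByVPSplittableFaces
import Summits.ValiantsHypothesis.ValiantsHypothesis.Theorems.BarrierLeverCubeHalvingDefs

/-!
# Route BarrierLever — item `PartitionMinorsHitByVP` (stmt-ValiantsHypothesis-19717):
# SPLITTABLE CLASSES of row families (explicit halving certificates) and the HALVING bridge

Helper file (`--supports stmt-ValiantsHypothesis-19717`; cell valiant-natproofs, rung V4, 𝒟-side door (c),
prover seat val-np-p1 gen 9). Closes NO item; definition-free. Supplies HYPOTHESES for the engine
`SubsetSum.exists_det_ne_zero` / the assembly `SubsetSum.partitionMinor_hit_of_isSplittable_face`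
(«IsSplittable rows × FACE columns are hit»):

* `isSplittable_singletons` — `{ {i} : i ∈ S }`, `|S| = 2^κ` (split by the indicator of half of `S`, level `1`);
* `isSplittable_ball` — the radius-`1` Hamming ball `{∅} ∪ { {i} : i ∈ S }`, `|S| + 1 = 2^κ` (indicator of a
  `2^(κ-1)`-subset, level `0`; the halves are a smaller ball and a family of singletons) — the TNS-killer rows;
* **`isSplittable_of_symmDiff_closed`** — every family of `2^κ` sets closed under TRIPLE symmetric difference
  (`A ∆ B ∆ C`), i.e. every coset of a binary linear code read as a family of subsets (faces of the cube,
  even-weight demicubes, Hamming / Reed–Muller codes, …): split by a coordinate `i` on which the family is not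
  constant (functional `e_i`, level `0`); the translation `U ↦ U ∆ U₀ ∆ U₁` (`i ∉ U₀`, `i ∈ U₁`) swaps the two
  halves, so they have equal size, and both halves are again triple-`∆`-closed;
* **`isSplittable_of_cubeHalving`** — the bridge: `(∀ κ' ≤ κ, CubeHalving h κ')` makes EVERY family of `2^κ`
  subsets of `Fin h` splittable — so the HALVING / EVEN-SPLIT lemma (typed in `…CubeHalvingDefs`, owner
  val-np-p3 g4) is exactly what turns «splittable rows × face columns» into «all rows × face columns».

Corollaries through `partitionMinor_hit_of_isSplittable_face` (val-np-p6 g3's additive door underneath):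
`partitionMinor_hit_of_symmDiff_closed_face` (coset-of-a-code rows × face columns, UNCONDITIONAL, `b = 5`,
`h ≥ 2`, uniform in `κ ≤ h`) and `partitionMinor_hit_face_of_cubeHalving` (ALL `2^κ` rows × face columns, CONDITIONAL
on `CubeHalving h κ'` for `κ' ≤ κ`).

WHAT THIS IS NOT: no proof of `CubeHalving`; Hamming balls of radius `≥ 2` and general down-sets are not
treated; nothing on crux 14610.
-/

set_option linter.dupNamespace false

namespace Summit.ValiantsHypothesis.ValiantsHypothesis.Theorems.BarrierLever.SubsetSum

open Finset
open scoped symmDiff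

variable {h : ℕ}

/-! ## 1. Singletons and the radius-one ball -/

/-- A one-element family is splittable of depth `0`. -/
theorem isSplittable_zero (U : Finset (Fin h)) : IsSplittable 0 ({U} : Finset (Finset (Fin h))) := by
  simp [IsSplittable]

/-- The family of singletons `{ {i} : i ∈ S }` with `|S| = 2^κ` is splittable of depth `κ`. -/
theorem isSplittable_singletons : ∀ (κ : ℕ) (S : Finset (Fin h)), S.card = 2 ^ κ →
    IsSplittable κ (S.image fun i => ({i} : Finset (Fin h)))
  | 0, S, hS => by
    obtain ⟨i, rfl⟩ := Finset.card_eq_one.mp (by simpa using hS)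
    simpa using isSplittable_zero ({i} : Finset (Fin h))
  | κ + 1, S, hS => by
    -- choose half of `S`
    obtain ⟨S', hS'S, hS'⟩ := Finset.exists_subset_card_eq (s := S) (n := 2 ^ κ)
      (by rw [hS, pow_succ]; omega)
    have hinj : Function.Injective fun i : Fin h => ({i} : Finset (Fin h)) := fun i j hij =>
      Finset.singleton_injective hij
    refine ⟨S'.image fun i => ({i} : Finset (Fin h)), Finset.image_subset_image hS'S,
      ⟨fun k => if k ∈ S' then 1 else 0, 1, ?_⟩, isSplittable_singletons κ S' hS', ?_⟩
    · intro U hU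
      obtain ⟨i, hi, rfl⟩ := Finset.mem_image.mp hU
      rw [Finset.sum_singleton, Finset.mem_image]
      constructor
      · intro h1
        refine ⟨i, ?_, rfl⟩
        by_contra hi'
        rw [if_neg hi'] at h1
        exact zero_ne_one h1
      · rintro ⟨j, hj, hji⟩
        rw [Finset.singleton_injective hji] at hj
        rw [if_pos hj]
    · have hsd : S.image (fun i => ({i} : Finset (Fin h))) \ S'.image (fun i => ({i} : Finset (Fin h))) =
          (S \ S').image fun i => ({i} : Finset (Fin h)) := by
        rw [Finset.image_sdiff_of_injOn hinj.injOn hS'S]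
      rw [hsd]
      refine isSplittable_singletons κ (S \ S') ?_
      rw [Finset.card_sdiff_of_subset hS'S, hS, hS', pow_succ]
      omega

/-- The radius-one Hamming ball `{∅} ∪ { {i} : i ∈ S }` with `|S| + 1 = 2^κ` is splittable of depth `κ`
(these are the rows of the TNS-killer layouts). -/
theorem isSplittable_ball : ∀ (κ : ℕ) (S : Finset (Fin h)), S.card + 1 = 2 ^ κ →
    IsSplittable κ (insert ∅ (S.image fun i => ({i} : Finset (Fin h))))
  | 0, S, hS => by
    have : S = ∅ := Finset.card_eq_zero.mp (by simpa using hS)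
    subst this
    simpa using isSplittable_zero (∅ : Finset (Fin h))
  | κ + 1, S, hS => by
    -- `S'` = the `2^κ` elements whose singletons go to the far half; the ball over `S \ S'` stays
    obtain ⟨S', hS'S, hS'⟩ := Finset.exists_subset_card_eq (s := S) (n := 2 ^ κ)
      (by rw [pow_succ] at hS; omega)
    have hinj : Function.Injective fun i : Fin h => ({i} : Finset (Fin h)) := fun i j hij =>
      Finset.singleton_injective hij
    have hnotmem : (∅ : Finset (Fin h)) ∉ S.image fun i => ({i} : Finset (Fin h)) := by
      simp
    -- the near half: the ball over `S \ S'`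
    refine ⟨insert ∅ ((S \ S').image fun i => ({i} : Finset (Fin h))), ?_,
      ⟨fun k => if k ∈ S' then 1 else 0, 0, ?_⟩, ?_, ?_⟩
    · exact Finset.insert_subset_insert _ (Finset.image_subset_image Finset.sdiff_subset)
    · intro U hU
      rcases Finset.mem_insert.mp hU with rfl | hU'
      · simp
      · obtain ⟨i, hi, rfl⟩ := Finset.mem_image.mp hU'
        rw [Finset.sum_singleton, Finset.mem_insert, Finset.mem_image]
        constructor
        · intro h0
          refine Or.inr ⟨i, Finset.mem_sdiff.mpr ⟨hi, fun hi' => ?_⟩, rfl⟩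
          rw [if_pos hi'] at h0
          exact one_ne_zero h0
        · rintro (h0 | ⟨j, hj, hji⟩)
          · exact absurd h0 (Finset.singleton_ne_empty i)
          · rw [Finset.singleton_injective hji] at hj
            rw [if_neg (Finset.mem_sdiff.mp hj).2]
    · refine isSplittable_ball κ (S \ S') ?_
      rw [Finset.card_sdiff_of_subset hS'S, hS']
      rw [pow_succ] at hS
      omega
    · have hsd : insert ∅ (S.image fun i => ({i} : Finset (Fin h))) \
          insert ∅ ((S \ S').image fun i => ({i} : Finset (Fin h))) =
          S'.image fun i => ({i} : Finset (Fin h)) := by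
        ext U
        simp only [Finset.mem_sdiff, Finset.mem_insert, Finset.mem_image, not_or, not_exists, not_and]
        constructor
        · rintro ⟨hU | ⟨i, hi, rfl⟩, hne, hno⟩
          · exact absurd hU hne
          · refine ⟨i, ?_, rfl⟩
            by_contra hi'
            exact hno i ⟨hi, hi'⟩ rfl
        · rintro ⟨i, hi, rfl⟩
          refine ⟨Or.inr ⟨i, hS'S hi, rfl⟩, Finset.singleton_ne_empty i, fun j hj hji => ?_⟩
          rw [Finset.singleton_injective hji] at hj
          exact hj.2 hi
      rw [hsd]
      exact isSplittable_singletons κ S' hS'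

/-! ## 2. Triple-symmetric-difference-closed families (cosets of binary linear codes) -/

/-- **Cosets of binary linear codes are splittable.** A family of `2^κ` subsets of `Fin h` closed under
`A ∆ B ∆ C` is splittable of depth `κ`. -/
theorem isSplittable_of_symmDiff_closed : ∀ (κ : ℕ) (𝒰 : Finset (Finset (Fin h))),
    (∀ A ∈ 𝒰, ∀ B ∈ 𝒰, ∀ C ∈ 𝒰, A ∆ B ∆ C ∈ 𝒰) → 𝒰.card = 2 ^ κ → IsSplittable κ 𝒰
  | 0, 𝒰, _, hcard => by simpa [IsSplittable] using hcard
  | κ + 1, 𝒰, hΔ, hcard => by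
    -- two distinct members, hence a separating coordinate `i`
    have h2 : 1 < 𝒰.card := by rw [hcard, pow_succ]; have := Nat.one_le_two_pow (n := κ); omega
    obtain ⟨U₀, hU₀, U₁, hU₁, hne⟩ := Finset.one_lt_card.mp h2
    obtain ⟨i, hi⟩ : ∃ i, ¬ (i ∈ U₀ ↔ i ∈ U₁) := by
      by_contra hcon
      push Not at hcon
      exact hne (Finset.ext hcon)
    -- WLOG `i ∉ U₀`, `i ∈ U₁` (otherwise swap)
    wlog h01 : i ∉ U₀ ∧ i ∈ U₁ generalizing U₀ U₁
    · have h10 : i ∉ U₁ ∧ i ∈ U₀ := by tauto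
      exact this U₁ hU₁ U₀ hU₀ hne.symm (fun h' => hi h'.symm) h10
    obtain ⟨hi₀, hi₁⟩ := h01
    set D : Finset (Fin h) := U₀ ∆ U₁ with hD
    have hiD : i ∈ D := by rw [hD, Finset.mem_symmDiff]; exact Or.inr ⟨hi₁, hi₀⟩
    -- translation by `D` is an involution of `𝒰` swapping the `i`-halves
    have htrans : ∀ U ∈ 𝒰, U ∆ D ∈ 𝒰 := fun U hU => by
      rw [hD, ← symmDiff_assoc]; exact hΔ U hU U₀ hU₀ U₁ hU₁
    have hmemi : ∀ U : Finset (Fin h), i ∈ U ∆ D ↔ i ∉ U := fun U => by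
      rw [Finset.mem_symmDiff]; tauto
    let Z := 𝒰.filter fun U => i ∉ U
    have hZcard2 : Z.card + Z.card = 𝒰.card := by
      have hc := Finset.card_filter_add_card_filter_not (s := 𝒰) (fun U => i ∈ U)
      -- translation by `D` maps the `i ∈` half bijectively onto the `i ∉` half
      have hinj : Function.Injective fun U : Finset (Fin h) => U ∆ D := fun U V hUV => by
        have := congrArg (· ∆ D) hUV
        simpa [symmDiff_symmDiff_cancel_right] using this
      have himage : (𝒰.filter fun U => i ∈ U).image (fun U => U ∆ D) = Z := by
        ext V
        simp only [Finset.mem_image, Finset.mem_filter, Z]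
        constructor
        · rintro ⟨U, ⟨hU, hiU⟩, rfl⟩
          exact ⟨htrans U hU, (hmemi U).not.mpr (not_not.mpr hiU)⟩
        · rintro ⟨hV, hiV⟩
          exact ⟨V ∆ D, ⟨htrans V hV, (hmemi V).mpr hiV⟩, symmDiff_symmDiff_cancel_right _ _⟩
      have hcard1 : (𝒰.filter fun U => i ∈ U).card = Z.card := by
        rw [← himage, Finset.card_image_of_injective _ hinj]
      rw [hcard1] at hc
      exact hc
    have hZcard : Z.card = 2 ^ κ := by rw [hcard, pow_succ] at hZcard2; omega
    have hCcard : (𝒰 \ Z).card = 2 ^ κ := by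
      rw [Finset.card_sdiff_of_subset (Finset.filter_subset _ _), hcard, hZcard, pow_succ]; omega
    refine ⟨Z, Finset.filter_subset _ _, ⟨fun k => if k = i then 1 else 0, 0, ?_⟩, ?_, ?_⟩
    · intro U hU
      rw [Finset.sum_ite_eq', Finset.mem_filter]
      constructor
      · intro h0
        refine ⟨hU, fun hiU => ?_⟩
        rw [if_pos hiU] at h0
        exact one_ne_zero h0
      · rintro ⟨-, hiU⟩
        rw [if_neg hiU]
    · refine isSplittable_of_symmDiff_closed κ Z ?_ hZcard
      intro A hA B hB C hC
      rw [Finset.mem_filter] at hA hB hC ⊢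
      refine ⟨hΔ A hA.1 B hB.1 C hC.1, ?_⟩
      simp only [Finset.mem_symmDiff]
      tauto
    · refine isSplittable_of_symmDiff_closed κ (𝒰 \ Z) ?_ hCcard
      intro A hA B hB C hC
      simp only [Finset.mem_sdiff, Finset.mem_filter, not_and, not_not, Z] at hA hB hC ⊢
      refine ⟨hΔ A hA.1 B hB.1 C hC.1, fun _ => ?_⟩
      have hA' := hA.2 hA.1
      have hB' := hB.2 hB.1
      have hC' := hC.2 hC.1
      simp only [Finset.mem_symmDiff]
      tauto

/-! ## 3. The HALVING bridge -/

/-- **HALVING ⇒ SPLITTABLE.** If `CubeHalving h κ'` holds for every `κ' ≤ κ`, every family of `2^κ` subsets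
of `Fin h` is splittable of depth `κ`. -/
theorem isSplittable_of_cubeHalving : ∀ (κ : ℕ), (∀ κ' ≤ κ, CubeHalving h κ') →
    ∀ 𝒰 : Finset (Finset (Fin h)), 𝒰.card = 2 ^ κ → IsSplittable κ 𝒰
  | 0, _, 𝒰, hcard => by simpa [IsSplittable] using hcard
  | κ + 1, H, 𝒰, hcard => by
    obtain ⟨Z, hZ, hZcard, a, t, hat⟩ := H (κ + 1) le_rfl 𝒰 hcard
    simp only [Nat.add_sub_cancel] at hZcard
    have H' : ∀ κ' ≤ κ, CubeHalving h κ' := fun κ' hκ' => H κ' (Nat.le_succ_of_le hκ')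
    refine ⟨Z, hZ, ⟨a, t, hat⟩, isSplittable_of_cubeHalving κ H' Z hZcard,
      isSplittable_of_cubeHalving κ H' (𝒰 \ Z) ?_⟩
    rw [Finset.card_sdiff_of_subset hZ, hcard, hZcard, pow_succ]
    omega

/-! ## 4. Through the door: faces of columns -/

open MvPolynomial Literature.Barriers.ValiantsHypothesis

/-- **Coset-of-a-code rows × face columns are hit** (unconditional): rows `u` injective, indexed by bit-vectors,
closed under triple symmetric difference; columns the face `[W₀, W₀ ⊔ T]`. -/
theorem partitionMinor_hit_of_symmDiff_closed_face (hh : 2 ≤ h) {κ : ℕ}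
    (u : (Fin κ → Bool) → Finset (Fin h)) (hu : Function.Injective u)
    (hΔ : ∀ i j k, u i ∆ u j ∆ u k ∈ univ.image u)
    (T : Fin κ ↪ Fin h) (W₀ : Finset (Fin h)) (hW₀ : ∀ c, T c ∉ W₀) :
    ∃ f ∈ SmallCircuits ℂ (h + h) 5,
      (Matrix.of fun i j : Fin κ → Bool => MvPolynomial.coeff
        (∑ a ∈ u i, Finsupp.single (Fin.castAdd h a) 1 +
          ∑ c ∈ W₀ ∪ (univ.filter fun c => j c).map T, Finsupp.single (Fin.natAdd h c) 1) f).det ≠ 0 := by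
  refine partitionMinor_hit_of_isSplittable_face hh u hu ?_ T W₀ hW₀
  refine isSplittable_of_symmDiff_closed κ _ ?_ ?_
  · intro A hA B hB C hC
    obtain ⟨i, -, rfl⟩ := Finset.mem_image.mp hA
    obtain ⟨j, -, rfl⟩ := Finset.mem_image.mp hB
    obtain ⟨k, -, rfl⟩ := Finset.mem_image.mp hC
    exact hΔ i j k
  · rw [Finset.card_image_of_injective _ hu, Finset.card_univ, card_bv]

/-- **ALL rows × face columns, conditional on CUBE HALVING**: if `CubeHalving h κ'` holds for all `κ' ≤ κ`,
every injective family of `2^κ` rows against a `κ`-dimensional face of columns is hit. -/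
theorem partitionMinor_hit_face_of_cubeHalving (hh : 2 ≤ h) {κ : ℕ} (H : ∀ κ' ≤ κ, CubeHalving h κ')
    (u : (Fin κ → Bool) → Finset (Fin h)) (hu : Function.Injective u)
    (T : Fin κ ↪ Fin h) (W₀ : Finset (Fin h)) (hW₀ : ∀ c, T c ∉ W₀) :
    ∃ f ∈ SmallCircuits ℂ (h + h) 5,
      (Matrix.of fun i j : Fin κ → Bool => MvPolynomial.coeff
        (∑ a ∈ u i, Finsupp.single (Fin.castAdd h a) 1 +
          ∑ c ∈ W₀ ∪ (univ.filter fun c => j c).map T, Finsupp.single (Fin.natAdd h c) 1) f).det ≠ 0 := by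
  refine partitionMinor_hit_of_isSplittable_face hh u hu ?_ T W₀ hW₀
  refine isSplittable_of_cubeHalving κ H _ ?_
  rw [Finset.card_image_of_injective _ hu, Finset.card_univ, card_bv]

end Summit.ValiantsHypothesis.ValiantsHypothesis.Theorems.BarrierLever.SubsetSum
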